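import Summits.Ventures.PercRepro.C026PFunPieces
import Summits.Ventures.PercRepro.C026PFunTreeOver

/-!
# The parabola `K = x²` lies in the band (p6, gen 16; mine-3 §31, CONJECTURE (P_par))

mine-3 §31: an (a b)-symmetric vertex with a- and b-edges of weight `α` is the normalised state
`(x, x²)`, `x = 1 − α`, so the C-028 slack of an (a b)-symmetric marked multigraph is governed by `(P)`
at PARABOLA states — CONJECTURE (P_par) = `0 ≤ G.pFun c x (fun v => x v ^ 2) F`.  Since
`K_min(x) ≤ x²` on `[0, 1]` (`kMin_le_sq`: for `x > ½` it is `(x − 1)(x² − x + 1) ≤ 0`), the parabola is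
inside the band, and every theorem of this lane specialises: `(P_par) ≥ 0` on stars, trees (forests)
and trees over good pendant skeletons.
-/

namespace PercRepro

/-- The parabola lies in the band: `K_min(x) ≤ x²` for `x ∈ [0, 1]`. -/
theorem kMin_le_sq {x : ℝ} (hx : 0 ≤ x ∧ x ≤ 1) : kMin x ≤ x ^ 2 := by
  rcases le_or_gt x (1 / 2) with h | h
  · rw [kMin_eq_zero_of_le h]
    positivity
  · rw [kMin_eq_of_half_le h.le hx.2, div_le_iff₀ (by linarith)]
    nlinarith [sq_nonneg (x - 1), sq_nonneg x, hx.2, mul_nonneg (sub_nonneg.2 hx.2) (sq_nonneg x)]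

namespace MultiGraph

open Finset

variable {V E : Type*} [Fintype V] [DecidableEq V] [Fintype E] [DecidableEq E] {G : MultiGraph V E}

/-- **(P_par) on every tree rooted at the probe** (THEOREM T at parabola states). -/
theorem IsTree.pFun_par_nonneg {c : V} {F : Finset E} (h : IsTree G c F) {x : V → ℝ}
    (hx : ∀ v, 0 ≤ x v ∧ x v ≤ 1) : 0 ≤ G.pFun c x (fun v => x v ^ 2) F :=
  h.pFun_nonneg hx fun v => kMin_le_sq (hx v)

/-- **(P_par) on every forest** (the probe's component a tree, the rest arbitrary). -/
theorem IsTree.pFun_par_nonneg_union {c : V} {F F' : Finset E} (h : IsTree G c F)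
    (hd : G.VDisjoint F F') (hc : ¬ G.Touches F' c) {x : V → ℝ} (hx : ∀ v, 0 ≤ x v ∧ x v ≤ 1) :
    0 ≤ G.pFun c x (fun v => x v ^ 2) (F ∪ F') :=
  h.pFun_nonneg_union hd hc hx fun v => kMin_le_sq (hx v)

/-- **(P_par) on one-ended paths.** -/
theorem ProbePath.pFun_par_nonneg {c : V} {F : Finset E} (hp : ProbePath G c F) {x : V → ℝ}
    (hx : ∀ v, 0 ≤ x v ∧ x v ≤ 1) : 0 ≤ G.pFun c x (fun v => x v ^ 2) F :=
  hp.pFun_nonneg x _ hx fun v => kMin_le_sq (hx v)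

/-- **(P_par) on trees over good pendant skeletons.** -/
theorem IsTreeOver.pFun_par_nonneg {Good : V → Finset E → Prop}
    (hGood : ∀ u F, Good u F → ∀ x K : V → ℝ, (∀ v, 0 ≤ x v ∧ x v ≤ 1) →
      (∀ v, kMin (x v) ≤ K v) → 0 ≤ G.pFun u x K F)
    {c : V} {F : Finset E} (h : IsTreeOver G Good c F) {x : V → ℝ}
    (hx : ∀ v, 0 ≤ x v ∧ x v ≤ 1) : 0 ≤ G.pFun c x (fun v => x v ^ 2) F :=
  h.pFun_nonneg hGood hx fun v => kMin_le_sq (hx v)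

/-- **(P_par) on every star** (THEOREM S at parabola states). -/
theorem pFun_star_par_nonneg {ι : Type*} [Fintype ι] [DecidableEq ι] {x : Option ι → ℝ}
    (hx : ∀ v, 0 ≤ x v ∧ x v ≤ 1) : 0 ≤ (star ι).pFun none x (fun v => x v ^ 2) univ :=
  pFun_star_nonneg hx fun v => kMin_le_sq (hx v)

end MultiGraph

end PercRepro
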